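import Mathlib.Analysis.SpecialFunctions.Gamma.Beta
import Mathlib.Analysis.SpecialFunctions.Pow.Complex
import Mathlib.Tactic.LinearCombination
import HarnessLib
import Literature.Analysis.SpecialFunctions.GammaMultiplication

/-!
# Γ-product values behind the radical period constants of the Fermat surface X^2_9 (proved values)

Topic: `Literature/Analysis/SpecialFunctions`. Deligne's normalised period constant of a Hodge
character `a` of the Fermat surface `X^2_9` is `Γ̃(a) = (2πi)^{-2}∏Γ(aᵢ/9)` (Deligne, LNM 900 I §7,
Thm. 7.15). The unique `(ℤ/9)^×`-orbit with `Γ̃ ∉ ℚ(ζ₉)` has representatives `(1,4,6,7)` and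
`(2,3,5,8)`; this file PROVES

  `Γ(1/9)Γ(4/9)Γ(2/3)Γ(7/9) = 4π²·3^{-1/3}`,  `Γ(2/9)Γ(1/3)Γ(5/9)Γ(8/9) = 4π²·3^{-2/3}`,

i.e. `Γ̃(1,4,6,7) = −3^{−1/3}`, `Γ̃(2,3,5,8) = −3^{−2/3}` (3-adic radical exponents `1/6`, `1/3`), from
Gauss's triplication formula (`GaussMultiplicationFormula_holds`, `n = 3`, this directory) and Euler's
reflection formula (`Real.Gamma_mul_Gamma_one_sub`, `Real.sin_pi_div_three`). Classical `Γ`-calculus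
(DLMF 5.5.3, 5.5.6), proved, not cited; no named fact introduced. Completes the kernel certification of
all three radical orbits of the pub-hlocus ABSHODGE v1 sweep (REFEREE.md R10–R11, open cell V6).

HONEST FRAMING (cell pub-hlocus): certified instances and evidence bearing on the general Hodge
conjecture; no claim.

## Sources
* P. Deligne, *Hodge cycles on abelian varieties*, LNM 900, Springer 1982, I §7, Thm. 7.15.
* NIST DLMF §5.5: 5.5.3 (reflection), 5.5.6 (multiplication). https://dlmf.nist.gov/5.5
-/

noncomputable section

open Real

namespace Literature.Analysis.SpecialFunctions

/-- Real Gauss triplication at `x = 1/9`: `Γ(1/9)Γ(4/9)Γ(7/9) = 2π·3^{1/6}·Γ(1/3)`. [cite: DLMF, 5.5.6] -/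
theorem Real_Gamma_triplication_one_ninth :
    Gamma (1/9) * Gamma (4/9) * Gamma (7/9) = 2 * π * 3 ^ ((1:ℝ)/6) * Gamma (1/3) := by
  have h := GaussMultiplicationFormula_holds 3 (((1:ℝ)/9 : ℝ) : ℂ) (by norm_num) (by
    intro m hm
    have := congrArg Complex.re hm
    simp at this
    linarith [(Nat.cast_nonneg m : (0:ℝ) ≤ m)])
  simp only [Finset.prod_range_succ, Finset.prod_range_zero, one_mul] at h
  have e1 : ((3:ℕ):ℂ) * (((1:ℝ)/9 : ℝ) : ℂ) = (((1:ℝ)/3 : ℝ) : ℂ) := by push_cast; ring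
  have e2 : (((1:ℝ)/9 : ℝ) : ℂ) + ((0:ℕ):ℂ) / ((3:ℕ):ℂ) = (((1:ℝ)/9 : ℝ) : ℂ) := by push_cast; ring
  have e3 : (((1:ℝ)/9 : ℝ) : ℂ) + ((1:ℕ):ℂ) / ((3:ℕ):ℂ) = (((4:ℝ)/9 : ℝ) : ℂ) := by push_cast; ring
  have e4 : (((1:ℝ)/9 : ℝ) : ℂ) + ((2:ℕ):ℂ) / ((3:ℕ):ℂ) = (((7:ℝ)/9 : ℝ) : ℂ) := by push_cast; ring
  have e5 : (2 * (π:ℂ)) ^ ((1 - ((3:ℕ):ℂ)) / 2) = ((2 * π)⁻¹ : ℝ) := by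
    rw [show (1 - ((3:ℕ):ℂ)) / 2 = -1 by push_cast; ring, Complex.cpow_neg_one]; push_cast; ring
  have e6 : ((3:ℕ):ℂ) ^ ((((1:ℝ)/3 : ℝ) : ℂ) - 1/2) = (((3:ℝ) ^ (-(1:ℝ)/6) : ℝ) : ℂ) := by
    rw [show ((((1:ℝ)/3 : ℝ) : ℂ) - 1/2) = ((-(1:ℝ)/6 : ℝ) : ℂ) by push_cast; ring,
        show ((3:ℕ):ℂ) = ((3:ℝ):ℂ) by norm_num, ← Complex.ofReal_cpow (by norm_num)]
  rw [e1, e2, e3, e4, e5, e6, Complex.Gamma_ofReal, Complex.Gamma_ofReal, Complex.Gamma_ofReal,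
    Complex.Gamma_ofReal] at h
  have hr : Gamma (1/3) = (2 * π)⁻¹ * (3:ℝ) ^ (-(1:ℝ)/6) * (Gamma (1/9) * Gamma (4/9) * Gamma (7/9)) := by
    exact_mod_cast h
  have h3 : (3:ℝ) ^ (-(1:ℝ)/6) * 3 ^ ((1:ℝ)/6) = 1 := by
    rw [← Real.rpow_add (by norm_num)]; norm_num
  have hpi : (2 * π) ≠ 0 := by positivity
  calc Gamma (1/9) * Gamma (4/9) * Gamma (7/9)
      = (2 * π) * (3:ℝ) ^ ((1:ℝ)/6) * ((2 * π)⁻¹ * (3:ℝ) ^ (-(1:ℝ)/6) * (Gamma (1/9) * Gamma (4/9) * Gamma (7/9))) := by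
        have hc : (2 * π) * (2 * π)⁻¹ = 1 := mul_inv_cancel₀ hpi
        calc Gamma (1/9) * Gamma (4/9) * Gamma (7/9)
            = ((2 * π) * (2 * π)⁻¹) * ((3:ℝ) ^ (-(1:ℝ)/6) * 3 ^ ((1:ℝ)/6)) * (Gamma (1/9) * Gamma (4/9) * Gamma (7/9)) := by
              rw [hc, h3]; ring
          _ = _ := by ring
    _ = 2 * π * 3 ^ ((1:ℝ)/6) * Gamma (1/3) := by rw [← hr]

/-- Real Gauss triplication at `x = 2/9`: `Γ(2/9)Γ(5/9)Γ(8/9) = 2π·3^{-1/6}·Γ(2/3)`. [cite: DLMF, 5.5.6] -/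
theorem Real_Gamma_triplication_two_ninths :
    Gamma (2/9) * Gamma (5/9) * Gamma (8/9) = 2 * π * 3 ^ (-(1:ℝ)/6) * Gamma (2/3) := by
  have h := GaussMultiplicationFormula_holds 3 (((2:ℝ)/9 : ℝ) : ℂ) (by norm_num) (by
    intro m hm
    have := congrArg Complex.re hm
    simp at this
    linarith [(Nat.cast_nonneg m : (0:ℝ) ≤ m)])
  simp only [Finset.prod_range_succ, Finset.prod_range_zero, one_mul] at h
  have e1 : ((3:ℕ):ℂ) * (((2:ℝ)/9 : ℝ) : ℂ) = (((2:ℝ)/3 : ℝ) : ℂ) := by push_cast; ring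
  have e2 : (((2:ℝ)/9 : ℝ) : ℂ) + ((0:ℕ):ℂ) / ((3:ℕ):ℂ) = (((2:ℝ)/9 : ℝ) : ℂ) := by push_cast; ring
  have e3 : (((2:ℝ)/9 : ℝ) : ℂ) + ((1:ℕ):ℂ) / ((3:ℕ):ℂ) = (((5:ℝ)/9 : ℝ) : ℂ) := by push_cast; ring
  have e4 : (((2:ℝ)/9 : ℝ) : ℂ) + ((2:ℕ):ℂ) / ((3:ℕ):ℂ) = (((8:ℝ)/9 : ℝ) : ℂ) := by push_cast; ring
  have e5 : (2 * (π:ℂ)) ^ ((1 - ((3:ℕ):ℂ)) / 2) = ((2 * π)⁻¹ : ℝ) := by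
    rw [show (1 - ((3:ℕ):ℂ)) / 2 = -1 by push_cast; ring, Complex.cpow_neg_one]; push_cast; ring
  have e6 : ((3:ℕ):ℂ) ^ ((((2:ℝ)/3 : ℝ) : ℂ) - 1/2) = (((3:ℝ) ^ ((1:ℝ)/6) : ℝ) : ℂ) := by
    rw [show ((((2:ℝ)/3 : ℝ) : ℂ) - 1/2) = (((1:ℝ)/6 : ℝ) : ℂ) by push_cast; ring,
        show ((3:ℕ):ℂ) = ((3:ℝ):ℂ) by norm_num, ← Complex.ofReal_cpow (by norm_num)]
  rw [e1, e2, e3, e4, e5, e6, Complex.Gamma_ofReal, Complex.Gamma_ofReal, Complex.Gamma_ofReal,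
    Complex.Gamma_ofReal] at h
  have hr : Gamma (2/3) = (2 * π)⁻¹ * (3:ℝ) ^ ((1:ℝ)/6) * (Gamma (2/9) * Gamma (5/9) * Gamma (8/9)) := by
    exact_mod_cast h
  have h3 : (3:ℝ) ^ (-(1:ℝ)/6) * 3 ^ ((1:ℝ)/6) = 1 := by
    rw [← Real.rpow_add (by norm_num)]; norm_num
  have hpi : (2 * π) ≠ 0 := by positivity
  calc Gamma (2/9) * Gamma (5/9) * Gamma (8/9)
      = (2 * π) * (3:ℝ) ^ (-(1:ℝ)/6) * ((2 * π)⁻¹ * (3:ℝ) ^ ((1:ℝ)/6) * (Gamma (2/9) * Gamma (5/9) * Gamma (8/9))) := by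
        have hc : (2 * π) * (2 * π)⁻¹ = 1 := mul_inv_cancel₀ hpi
        calc Gamma (2/9) * Gamma (5/9) * Gamma (8/9)
            = ((2 * π) * (2 * π)⁻¹) * ((3:ℝ) ^ (-(1:ℝ)/6) * 3 ^ ((1:ℝ)/6)) * (Gamma (2/9) * Gamma (5/9) * Gamma (8/9)) := by
              rw [hc, h3]; ring
          _ = _ := by ring
    _ = 2 * π * 3 ^ (-(1:ℝ)/6) * Gamma (2/3) := by rw [← hr]

/-- `√3 = 3^{1/2}` and `3^{1/6}/3^{1/2} = 3^{-1/3}`. [folklore] -/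
private lemma three_pow_aux : (3:ℝ) ^ ((1:ℝ)/6) / √3 = 3 ^ (-(1:ℝ)/3) := by
  rw [Real.sqrt_eq_rpow, ← Real.rpow_sub (by norm_num)]; norm_num

/-- `3^{-1/6}/3^{1/2} = 3^{-2/3}`. [folklore] -/
private lemma three_pow_aux' : (3:ℝ) ^ (-(1:ℝ)/6) / √3 = 3 ^ (-(2:ℝ)/3) := by
  rw [Real.sqrt_eq_rpow, ← Real.rpow_sub (by norm_num)]; norm_num

/-- ABSHODGE table, X^2_9, orbit rep (1,4,6,7): ∏Γ(aᵢ/9) = 4π²·3^{-1/3}, i.e. Γ̃ = −3^{−1/3} (e_3 = 1/6).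
[cite: DLMF, 5.5.6] [cite: Deligne1982HodgeCycles, I Thm 7.15] -/
theorem Real_Gamma_prod_d9_orbit_1467 :
    Gamma (1/9) * Gamma (4/9) * Gamma (6/9) * Gamma (7/9) = 4 * π ^ 2 * 3 ^ (-(1:ℝ)/3) := by
  have h := Real_Gamma_triplication_one_ninth
  have refl3 : Gamma (1/3) * Gamma (2/3) = 2 * π / √3 := by
    have h := Gamma_mul_Gamma_one_sub (1/3 : ℝ)
    rw [show (1:ℝ) - 1/3 = 2/3 by norm_num, show Real.pi * (1/3 : ℝ) = Real.pi / 3 by ring,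
        Real.sin_pi_div_three] at h
    rw [h, div_div_eq_mul_div]
    ring
  have hs : (0:ℝ) < √3 := by positivity
  calc Gamma (1/9) * Gamma (4/9) * Gamma (6/9) * Gamma (7/9)
      = (Gamma (1/9) * Gamma (4/9) * Gamma (7/9)) * Gamma (2/3) := by norm_num; ring
    _ = 2 * π * 3 ^ ((1:ℝ)/6) * (Gamma (1/3) * Gamma (2/3)) := by rw [h]; ring
    _ = 2 * π * 3 ^ ((1:ℝ)/6) * (2 * π / √3) := by rw [refl3]
    _ = 4 * π ^ 2 * ((3:ℝ) ^ ((1:ℝ)/6) / √3) := by ring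
    _ = 4 * π ^ 2 * 3 ^ (-(1:ℝ)/3) := by rw [three_pow_aux]

/-- ABSHODGE table, X^2_9, orbit member (2,3,5,8): ∏Γ(aᵢ/9) = 4π²·3^{-2/3}, i.e. Γ̃ = −3^{−2/3} (e_3 = 1/3).
[cite: DLMF, 5.5.6] [cite: Deligne1982HodgeCycles, I Thm 7.15] -/
theorem Real_Gamma_prod_d9_orbit_2358 :
    Gamma (2/9) * Gamma (3/9) * Gamma (5/9) * Gamma (8/9) = 4 * π ^ 2 * 3 ^ (-(2:ℝ)/3) := by
  have h := Real_Gamma_triplication_two_ninths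
  have refl3 : Gamma (1/3) * Gamma (2/3) = 2 * π / √3 := by
    have h := Gamma_mul_Gamma_one_sub (1/3 : ℝ)
    rw [show (1:ℝ) - 1/3 = 2/3 by norm_num, show Real.pi * (1/3 : ℝ) = Real.pi / 3 by ring,
        Real.sin_pi_div_three] at h
    rw [h, div_div_eq_mul_div]
    ring
  calc Gamma (2/9) * Gamma (3/9) * Gamma (5/9) * Gamma (8/9)
      = (Gamma (2/9) * Gamma (5/9) * Gamma (8/9)) * Gamma (1/3) := by norm_num; ring
    _ = 2 * π * 3 ^ (-(1:ℝ)/6) * (Gamma (1/3) * Gamma (2/3)) := by rw [h]; ring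
    _ = 2 * π * 3 ^ (-(1:ℝ)/6) * (2 * π / √3) := by rw [refl3]
    _ = 4 * π ^ 2 * ((3:ℝ) ^ (-(1:ℝ)/6) / √3) := by ring
    _ = 4 * π ^ 2 * 3 ^ (-(2:ℝ)/3) := by rw [three_pow_aux']

end Literature.Analysis.SpecialFunctions
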